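import Summits.ABC.IUTFork.Charitable.Thm311D1PerPlace
import HarnessLib

/-!
# Branch D — the patching predicate `IndPatch` of `Charitable/Thm311D1PerPlace.lean`: a structural obstruction

Proof-only companion (abc-iut cell, rung LADDER-ABC:A2.D; abc-iut-w6-d069, filed as the kernel follow-up of the RQ7 second
read of p429915). TAKES NO SIDE on [IUTchIII] Cor. 3.12 or on any author; no `Prop` fact, no new definition, nothing asserted about
any genuine datum.

`Thm311D1PerPlace.lean` derives the uniform datum square `Cor312Vol.PilotKummerCompat` (hence S) from the PER-BAD-PLACE square
`PerPlaceKummerCompat` GIVEN the patching property `IndPatch S` of the carrier's indeterminacy group, proves `IndPatch` for ONE bad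
place (`indPatch_of_subsingleton_bad`) and records its status for several bad places as OPEN. The observation checked here is purely
about the frozen carrier (`Thm311Sig` / `Thm311Multirad`): the star packet at a bad place `v`,
`LogShells.StarPacket v = ∀ j : F_l^⋇, I^ℚ(^{S^±_{j+1}};D⊢_{v_ℚ(v)})`, and the star action `LogShells.starAut Φ v` depend on `v` ONLY
THROUGH `v_ℚ = T.over v` — print's (Ind2) acts «for each v_ℚ ∈ V^non_ℚ … by independent copies of Ism … on each of the direct summands
… [whose] cardinality … is equal to the cardinality of the set of v ∈ V that lie over v_ℚ» (S. Mochizuki, *Inter-universal Teichmüller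
theory III*, kurims (May 2020), Thm. 3.11 (i), p. 154), i.e. on the ONE packet at `v_ℚ` shared by all `v | v_ℚ`. Consequently, as soon as
two distinct bad places lie over the same `v_ℚ` and the indeterminacy group `⟨(Ind1)∪(Ind2)⟩` moves that star packet at all, the
family "`Φ` at `v`, identity at `v'`" cannot be patched: **`IndPatch S` FAILS** (`not_indPatch_of_two_bad_over_one`). Conversely, if the
indeterminacy group fixes every bad star packet pointwise, `IndPatch S` holds trivially (`indPatch_of_starAut_trivial`). So the
patching route from the per-place reading to S (`pilotKummerCompat_of_perPlace`) is available exactly in the "one bad place per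
rational prime, or inert indeterminacies" regime; for an index with two bad places over one `v_ℚ` and a live indeterminacy there,
a data-relative patching (agreement on the images of the (ii)(b) data only) would be needed instead — recorded for abc-iut-D1-prv /
abc-iut-D-ref, not pursued here. Whether print's (iii)(c) final clause (p. 158 l. 6–15) bears the uniform or the per-place reading is
NOT addressed. [claim: Mochizuki2012, status: disputed] (node texts); the two theorems are elementary bookkeeping on the typed carrier.
-/

noncomputable section

open Set

namespace Summit.ABC.IUTFork.Charitable

open Thm311 Cor312 Cor312Vol Literature.IUT.LogThetaLattice

variable {T : ThetaIndex} (S : LatticeSituation T)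

/-- The star action is componentwise: `(Φ ⋆_v x)_j = Φ_{j, v_ℚ(v)} (x_j)` (unfolding of `LogShells.starAut`). [folklore] -/
theorem starAut_apply (Φ : S.L.PacketAut) (v : T.V) (x : S.L.StarPacket v) (j : T.LabelStar) :
    S.L.starAut Φ v x j = Φ j.1 (T.over v) (x j) := by
  simp [LogShells.starAut]

/-- If a packet-automorphism family is the identity at every `(j, v_ℚ(v))`, `j ∈ F_l^⋇`, its star action at `v` is the identity.
[folklore] -/
theorem starAut_eq_refl_of_components (Φ : S.L.PacketAut) (v : T.V)
    (h : ∀ j : T.LabelStar, Φ j.1 (T.over v) = LinearEquiv.refl ℚ _) :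
    S.L.starAut Φ v = LinearEquiv.refl ℚ _ := by
  ext x j
  rw [starAut_apply, h j]
  rfl

/-- Conversely, the star action at `v` determines the components of the family at every `(j, v_ℚ(v))`, `j ∈ F_l^⋇`: if
`Φ ⋆_v = Φ' ⋆_v` then `Φ_{j, v_ℚ(v)} = Φ'_{j, v_ℚ(v)}`. [folklore] -/
theorem component_eq_of_starAut_eq {Φ Φ' : S.L.PacketAut} {v : T.V} (h : S.L.starAut Φ v = S.L.starAut Φ' v)
    (j : T.LabelStar) : Φ j.1 (T.over v) = Φ' j.1 (T.over v) := by
  classical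
  ext y
  have := congrArg (fun e : S.L.StarPacket v ≃ₗ[ℚ] S.L.StarPacket v => e (Pi.single j y) j) h
  simpa [starAut_apply] using this

/-- **Structural obstruction to patching.** If two DISTINCT bad places `v ≠ v'` lie over the same rational place
(`T.over v' = T.over v`) and some element `Φ` of the indeterminacy group `⟨(Ind1)∪(Ind2)⟩` moves the star packet at `v`
(`Φ ⋆_v ≠ id`), then the carrier does NOT have the patching property `IndPatch` of `Thm311D1PerPlace.lean`: the bad-place-indexed
family (`Φ` at `v`, `1` elsewhere) admits no single `Ψ` with `Ψ ⋆_v = Φ ⋆_v` and `Ψ ⋆_{v'} = 1 ⋆_{v'}`, because both conditions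
constrain the same components `Ψ_{j, v_ℚ(v)}`. Elementary; no side taken. [folklore] -/
theorem not_indPatch_of_two_bad_over_one {v v' : T.V} (hv : v ∈ T.Vbad) (hv' : v' ∈ T.Vbad) (hne : v ≠ v')
    (hover : T.over v' = T.over v) {Φ : S.L.PacketAut}
    (hΦ : Φ ∈ Subgroup.closure (S.L.Ind1Family ∪ S.L.Ind2Family))
    (hmove : S.L.starAut Φ v ≠ LinearEquiv.refl ℚ _) : ¬ IndPatch S := by
  classical
  intro hpatch
  obtain ⟨Ψ, -, hΨ⟩ := hpatch (fun w _ => if w = v then Φ else 1) (by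
    intro w hw
    by_cases h : w = v
    · simp only [h, if_true]; exact hΦ
    · simp only [h, if_false]; exact one_mem _)
  have hΨv : S.L.starAut Ψ v = S.L.starAut Φ v := by
    simpa using hΨ v hv
  have hΨv' : S.L.starAut Ψ v' = S.L.starAut 1 v' := by
    simpa [hne.symm] using hΨ v' hv'
  -- at `v'` every component of `Ψ` over `v_ℚ(v') = v_ℚ(v)` is the identity …
  have hcomp' : ∀ j : T.LabelStar, Ψ j.1 (T.over v') = LinearEquiv.refl ℚ _ := by
    intro j
    rw [component_eq_of_starAut_eq S hΨv' j]
    rfl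
  -- … hence so is every component over `v_ℚ(v)`, and the star action of `Ψ` at `v` is the identity
  have hcomp : ∀ j : T.LabelStar, Ψ j.1 (T.over v) = LinearEquiv.refl ℚ _ := fun j => hover ▸ hcomp' j
  have hrefl : S.L.starAut Ψ v = LinearEquiv.refl ℚ _ := starAut_eq_refl_of_components S Ψ v hcomp
  exact hmove (hΨv ▸ hrefl)

/-- **The inert regime.** If every element of `⟨(Ind1)∪(Ind2)⟩` fixes every bad star packet pointwise, patching holds (take `Ψ = 1`).
Together with `indPatch_of_subsingleton_bad` this brackets the patching route of `Thm311D1PerPlace.lean`. [folklore] -/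
theorem indPatch_of_starAut_trivial
    (h : ∀ Φ ∈ Subgroup.closure (S.L.Ind1Family ∪ S.L.Ind2Family), ∀ v ∈ T.Vbad,
      S.L.starAut Φ v = LinearEquiv.refl ℚ _) : IndPatch S := by
  intro Φv hΦv
  refine ⟨1, one_mem _, fun v hv => ?_⟩
  rw [h 1 (one_mem _) v hv, h (Φv v hv) (hΦv v hv) v hv]

/-- **Consequence for the per-place route to S.** Under the obstruction hypotheses (two bad places over one rational place, a live
indeterminacy there) the hypothesis `hpatch : IndPatch S` of `pilotKummerCompat_of_perPlace` / `S_of_perPlace` is unsatisfiable, so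
on such index data those two theorems are vacuous; the per-place reading then needs a data-relative patching argument (not typed
here). Bookkeeping restatement of `not_indPatch_of_two_bad_over_one`. [folklore] -/
theorem indPatch_hypothesis_vacuous_of_two_bad_over_one {v v' : T.V} (hv : v ∈ T.Vbad) (hv' : v' ∈ T.Vbad) (hne : v ≠ v')
    (hover : T.over v' = T.over v)
    (hlive : ∃ Φ ∈ Subgroup.closure (S.L.Ind1Family ∪ S.L.Ind2Family), S.L.starAut Φ v ≠ LinearEquiv.refl ℚ _) :
    IndPatch S → False := by
  obtain ⟨Φ, hΦ, hmove⟩ := hlive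
  exact not_indPatch_of_two_bad_over_one S hv hv' hne hover hΦ hmove

end Summit.ABC.IUTFork.Charitable

end
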